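import Summits.KontsevichZagierPeriods.Zeta5Search.Certificates.VIML3Termwise
import HarnessLib

/-!
# ζ(5) search — brown9 LEVEL 3: summation over `k₃` — the order-4 recurrence of `A(n)` for `n ≥ 12`, modulo (L-K3)/(L-NK) (cell `pub-zeta5`, certifier `cert-1`)

HONEST FRAMING: systematic search; recurrence certificates; no irrationality claim unless certified.

From the cleared termwise identity (`VIML3Termwise.termwise_cleared`) at integer points `x = k ∈ [0, n+4]`:
* `termwise_nat`: `Σ_i P_i(n) t_i(n,k) = G(n,k+1) − G(n,k)` with `t_i(n,k) = (−1)^k C(n+i,k) L(n+i,k) R(n+i,k)` and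
  `G(n,k) = (−1)^k C(n+4,k) Σ_ab M_ab(n,k) L(n,k+a)R(n,k+b) / (d(n) D(n,k))` (binomial identities `N₄ C(n+i,k) = C(n+4,k) π_i`,
  `C(n+4,k+1)(k+1) = C(n+4,k)(n+4−k)`);
* endpoints: `G(n,n+5) = 0` (`C(n+4,n+5) = 0`) and `G(n,0) = 0` — the latter from the DEGENERATE instances of (R-K2) and (L-K3)
  at `x = −1` (`eta00 n (−1) = 0`, `thQ0 n (−1) = 0`) plus two kernel-checked polynomial identities in `n` (`end0`, `end1`);
* telescoping and `VIMOuterSum.A_cast`: **`recurrence_of_L`** — for `n ≥ 12`, if (L-K3) and (L-NK) hold at every level `m ≥ n`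
  (`LK3At m`, `LNKAt m`: cert-2's `ModRedLK3*` line), then `opApply A n = 0`, i.e. `Σ_{i=0}^{4} P_i(n) A(n+i) = 0`
  (`Families/CellularVIMRecurrenceLaws`). The cases `n < 12` are finite computations (`VIML3Small`). No named facts.
-/

namespace Summit.KontsevichZagierPeriods.Zeta5Search.Certificates

namespace VIMInner.L3

open PolyReflect hiding A
open Finset
open Lean.Grind.CommRing (Expr)
open Families.CellularVIMRecurrenceLaws (P evalList A opApply)

/-! ### Objects -/

/-- `t_i(n,k) = (−1)^k C(n+i,k) · L(n+i,k) R(n+i,k)` — the `k₃ = k` term of `A(n+i)` (`VIMOuterSum.A_cast`). -/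
noncomputable def tm (n i k : ℕ) : ℚ := (-1) ^ k * (((n + i).choose k : ℕ) : ℚ) * (Lsum (n + i) k * Rsum (n + i) k)

/-- `S(n,y) = Σ_{a≤2,b≤1} M_ab(n,y) · L(n,y+a) R(n,y+b)` (the certificate's numerator combination at rational `y`). -/
noncomputable def Msum (n : ℕ) (y : ℚ) : ℚ :=
  peval eM00 (V n y) * (Lsum n y * Rsum n y) + peval eM01 (V n y) * (Lsum n y * Rsum n (y + 1)) + peval eM10 (V n y) * (Lsum n (y + 1) * Rsum n y) + peval eM11 (V n y) * (Lsum n (y + 1) * Rsum n (y + 1)) + peval eM20 (V n y) * (Lsum n (y + 2) * Rsum n y) + peval eM21 (V n y) * (Lsum n (y + 2) * Rsum n (y + 1))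

/-- The certificate `G(n,k) = (−1)^k C(n+4,k) S(n,k) / (d(n) D(n,k))` at natural `k`. -/
noncomputable def Gc (n k : ℕ) : ℚ := (-1) ^ k * (((n + 4).choose k : ℕ) : ℚ) * Msum n k / (dnv n * Dc n k)

/-! ### Small conversions -/

/-- `D(n,y) ≠ 0` whenever `y < 2n + 1` (all factors `2n − y + j`, `j ≥ 1`, are positive). -/
theorem Dc_ne_of_lt (n : ℕ) (y : ℚ) (hy : y < 2 * (n : ℚ) + 1) : Dc n y ≠ 0 := by
  simp only [Dc, eDc, peval_denOf_cons, peval_denOf_nil]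
  push_cast
  have h : ∀ j : ℚ, 1 ≤ j → (2 * (n : ℚ) + -1 * y + j) ^ 5 ≠ 0 := fun j hj => pow_ne_zero _ (by intro h; linarith)
  exact mul_ne_zero (h 1 (by norm_num)) (mul_ne_zero (h 2 (by norm_num)) (mul_ne_zero (h 3 (by norm_num))
    (mul_ne_zero (h 4 (by norm_num)) (mul_ne_zero (h 5 (by norm_num)) (mul_ne_zero (h 6 (by norm_num))
    (mul_ne_zero (h 7 (by norm_num)) (mul_ne_zero (h 8 (by norm_num)) one_ne_zero)))))))

/-- `eDc` evaluates to `Dc` (definition). -/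
theorem eDc_peval (n : ℕ) (x : ℚ) : peval eDc (V n x) = Dc n x := rfl

/-- The shifted numerator atoms: `peval (substs (τ 0 1) e) (V n y) = peval e (V n (y+1))`. -/
theorem shift01 (e : Expr) (he : varsLT 3 e = true) (n : ℕ) (y : ℚ) :
    peval (substs (τ ((0 : ℕ) : ℤ) (1 : ℤ)) e) (V n y) = peval e (V n (y + 1)) := by
  rw [peval_shift n 0 y 1 e he]; simp only [Nat.add_zero, Int.cast_one]

/-! ### Binomial identities -/

/-- `C(n+4,k+1)(k+1) = C(n+4,k)(n+4−k)` in `ℚ` for `k ≤ n+4`. -/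
theorem chooseB2 (n k : ℕ) (hk : k ≤ n + 4) :
    (((n + 4).choose (k + 1) : ℕ) : ℚ) * ((k : ℚ) + 1) = (((n + 4).choose k : ℕ) : ℚ) * ((n : ℚ) + 4 - k) := by
  have h := Nat.choose_succ_right_eq (n + 4) k
  have h' := congrArg (Nat.cast : ℕ → ℚ) h
  push_cast [Nat.cast_sub hk] at h'
  linarith

/-- One absorption step in `ℚ`: `C(m,k)·m₁ = C(m₁,k)(m₁−k)` for `m₁ = m+1`, `k ≤ m₁` (caller-normalised `m₁`). -/
theorem choose_step (m m1 : ℕ) (hm : m1 = m + 1) (k : ℕ) (hk : k ≤ m1) :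
    ((m.choose k : ℕ) : ℚ) * (m1 : ℚ) = ((m1.choose k : ℕ) : ℚ) * ((m1 : ℚ) - k) := by
  subst hm
  have h := Nat.choose_mul_succ_eq m k
  have h' := congrArg (Nat.cast : ℕ → ℚ) h
  push_cast [Nat.cast_sub hk] at h' ⊢
  linarith

/-- `N₄·C(n+4,k) = C(n+4,k)·π_4`. -/
theorem chooseB1_4 (n k : ℕ) :
    ((n : ℚ) + 1) * ((n : ℚ) + 2) * ((n : ℚ) + 3) * ((n : ℚ) + 4) * (((n + 4).choose k : ℕ) : ℚ) =
      (((n + 4).choose k : ℕ) : ℚ) * (((n : ℚ) + 1) * ((n : ℚ) + 2) * ((n : ℚ) + 3) * ((n : ℚ) + 4)) := by ring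

/-- `N₄·C(n+3,k) = C(n+4,k)·π_3` for `k ≤ n+4`. -/
theorem chooseB1_3 (n k : ℕ) (hk : k ≤ n + 4) :
    ((n : ℚ) + 1) * ((n : ℚ) + 2) * ((n : ℚ) + 3) * ((n : ℚ) + 4) * (((n + 3).choose k : ℕ) : ℚ) =
      (((n + 4).choose k : ℕ) : ℚ) * (((n : ℚ) + 4 - k) * ((n : ℚ) + 1) * ((n : ℚ) + 2) * ((n : ℚ) + 3)) := by
  have h4 := choose_step (n + 3) (n + 4) rfl k (by omega)
  push_cast at h4
  linear_combination (((n : ℚ) + 1) * ((n : ℚ) + 2) * ((n : ℚ) + 3)) * h4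

/-- `N₄·C(n+2,k) = C(n+4,k)·π_2` for `k ≤ n+4`. -/
theorem chooseB1_2 (n k : ℕ) (hk : k ≤ n + 4) :
    ((n : ℚ) + 1) * ((n : ℚ) + 2) * ((n : ℚ) + 3) * ((n : ℚ) + 4) * (((n + 2).choose k : ℕ) : ℚ) =
      (((n + 4).choose k : ℕ) : ℚ) * (((n : ℚ) + 3 - k) * ((n : ℚ) + 4 - k) * ((n : ℚ) + 1) * ((n : ℚ) + 2)) := by
  rcases Nat.lt_or_ge (n + 3) k with h | h
  · have hk4 : k = n + 4 := by omega
    subst hk4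
    rw [Nat.choose_eq_zero_of_lt (by omega)]; push_cast; ring
  · have h3 := choose_step (n + 2) (n + 3) rfl k (by omega)
    have h4 := choose_step (n + 3) (n + 4) rfl k (by omega)
    push_cast at h3 h4
    linear_combination (((n : ℚ) + 1) * ((n : ℚ) + 2) * ((n : ℚ) + 4)) * h3
      + (((n : ℚ) + 1) * ((n : ℚ) + 2) * ((n : ℚ) + 3 - k)) * h4

/-- `N₄·C(n+1,k) = C(n+4,k)·π_1` for `k ≤ n+4`. -/
theorem chooseB1_1 (n k : ℕ) (hk : k ≤ n + 4) :
    ((n : ℚ) + 1) * ((n : ℚ) + 2) * ((n : ℚ) + 3) * ((n : ℚ) + 4) * (((n + 1).choose k : ℕ) : ℚ) =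
      (((n + 4).choose k : ℕ) : ℚ) * (((n : ℚ) + 2 - k) * ((n : ℚ) + 3 - k) * ((n : ℚ) + 4 - k) * ((n : ℚ) + 1)) := by
  rcases Nat.lt_or_ge (n + 2) k with h | h
  · have hk4 : k = n + 3 ∨ k = n + 4 := by omega
    rcases hk4 with rfl | rfl <;> (rw [Nat.choose_eq_zero_of_lt (by omega)]; push_cast; ring)
  · have h2 := choose_step (n + 1) (n + 2) rfl k (by omega)
    have h3 := choose_step (n + 2) (n + 3) rfl k (by omega)
    have h4 := choose_step (n + 3) (n + 4) rfl k (by omega)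
    push_cast at h2 h3 h4
    linear_combination (((n : ℚ) + 1) * ((n : ℚ) + 3) * ((n : ℚ) + 4)) * h2
      + (((n : ℚ) + 1) * ((n : ℚ) + 4) * ((n : ℚ) + 2 - k)) * h3
      + (((n : ℚ) + 1) * ((n : ℚ) + 2 - k) * ((n : ℚ) + 3 - k)) * h4

/-- `N₄·C(n,k) = C(n+4,k)·π_0` for `k ≤ n+4`. -/
theorem chooseB1_0 (n k : ℕ) (hk : k ≤ n + 4) :
    ((n : ℚ) + 1) * ((n : ℚ) + 2) * ((n : ℚ) + 3) * ((n : ℚ) + 4) * ((n.choose k : ℕ) : ℚ) =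
      (((n + 4).choose k : ℕ) : ℚ) * (((n : ℚ) + 1 - k) * ((n : ℚ) + 2 - k) * ((n : ℚ) + 3 - k) * ((n : ℚ) + 4 - k)) := by
  rcases Nat.lt_or_ge (n + 1) k with h | h
  · have hk4 : k = n + 2 ∨ k = n + 3 ∨ k = n + 4 := by omega
    rcases hk4 with rfl | rfl | rfl <;> (rw [Nat.choose_eq_zero_of_lt (by omega)]; push_cast; ring)
  · rcases Nat.lt_or_ge n k with h' | h'
    · have hk1 : k = n + 1 := by omega
      subst hk1
      rw [Nat.choose_eq_zero_of_lt (by omega)]; push_cast; ring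
    · have h1 := choose_step n (n + 1) rfl k (by omega)
      have h2 := choose_step (n + 1) (n + 2) rfl k (by omega)
      have h3 := choose_step (n + 2) (n + 3) rfl k (by omega)
      have h4 := choose_step (n + 3) (n + 4) rfl k (by omega)
      push_cast at h1 h2 h3 h4
      linear_combination (((n : ℚ) + 2) * ((n : ℚ) + 3) * ((n : ℚ) + 4)) * h1
        + (((n : ℚ) + 1 - k) * ((n : ℚ) + 3) * ((n : ℚ) + 4)) * h2
        + (((n : ℚ) + 1 - k) * ((n : ℚ) + 2 - k) * ((n : ℚ) + 4)) * h3
        + (((n : ℚ) + 1 - k) * ((n : ℚ) + 2 - k) * ((n : ℚ) + 3 - k)) * h4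

/-! ### The termwise identity at integer points -/

set_option maxHeartbeats 1000000 in
/-- `Σ_i P_i(n) t_i(n,k) = G(n,k+1) − G(n,k)` for `0 ≤ k ≤ n+4`, `n ≥ 12` (a long but routine clearing of denominators). -/
theorem termwise_nat (n : ℕ) (hn : 12 ≤ n) (hK : ∀ m, n ≤ m → LK3At m) (hN : ∀ m, n ≤ m → LNKAt m) (k : ℕ)
    (hk : k ≤ n + 4) :
    ((evalList (P 0) (n : ℤ) : ℤ) : ℚ) * tm n 0 k + ((evalList (P 1) (n : ℤ) : ℤ) : ℚ) * tm n 1 k + ((evalList (P 2) (n : ℤ) : ℤ) : ℚ) * tm n 2 k + ((evalList (P 3) (n : ℤ) : ℤ) : ℚ) * tm n 3 k + ((evalList (P 4) (n : ℤ) : ℤ) : ℚ) * tm n 4 k = Gc n (k + 1) - Gc n k := by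
  have hkq : (k : ℚ) ≤ (n : ℚ) + 4 := by exact_mod_cast hk
  have hnq : (12 : ℚ) ≤ n := by exact_mod_cast hn
  have hk0 : (0 : ℚ) ≤ k := Nat.cast_nonneg k
  have hx : (k : ℚ) + 7 < 2 * (n : ℚ) := by linarith
  have hD0 : Dc n (k : ℚ) ≠ 0 := Dc_ne_of_lt n k (by linarith)
  have hD1 : Dc n ((k : ℚ) + 1) ≠ 0 := Dc_ne_of_lt n ((k : ℚ) + 1) (by linarith)
  have hd : dnv n ≠ 0 := dnv_ne n
  have hkN : ((k : ℚ) + 1) * (((n : ℚ) + 1) * ((n : ℚ) + 2) * ((n : ℚ) + 3) * ((n : ℚ) + 4)) ≠ 0 := by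
    have h1 : (0 : ℚ) < (k : ℚ) + 1 := by linarith
    have h2 : (0 : ℚ) < (((n : ℚ) + 1) * ((n : ℚ) + 2) * ((n : ℚ) + 3) * ((n : ℚ) + 4)) := by positivity
    exact mul_ne_zero h1.ne' h2.ne'
  have e2 : ((k : ℚ) + 1 + 1) = (k : ℚ) + 2 := by ring
  have e3 : ((k : ℚ) + 1 + 2) = (k : ℚ) + 3 := by ring
  have hB2 := chooseB2 n k hk
  have hB0 := chooseB1_0 n k hk
  have hB1 := chooseB1_1 n k hk
  have hB2' := chooseB1_2 n k hk
  have hB3 := chooseB1_3 n k hk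
  have hB4 := chooseB1_4 n k
  have tw := termwise_cleared n (by omega) hK hN (k : ℚ) hx
  obtain ⟨hP0, hP1, hP2, hP3, hP4⟩ := ePl_peval n (k : ℚ)
  simp only [hP0, hP1, hP2, hP3, hP4, ePi_0_peval, ePi_1_peval, ePi_2_peval, ePi_3_peval, ePi_4_peval, eXp1_peval,
    eN4mx_peval, eN4_peval, eDn_peval, eDcp_peval, eDc_peval, shift01 eM00 CertM00_vars, shift01 eM01 CertM01_vars,
    shift01 eM10 CertM10_vars, shift01 eM11 CertM11_vars, shift01 eM20 CertM20_vars, shift01 eM21 CertM21_vars] at tw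
  unfold Gc tm Msum
  rw [Nat.add_zero]
  simp only [Nat.cast_succ, e2, e3, pow_succ]
  rw [div_sub_div _ _ (mul_ne_zero hd hD1) (mul_ne_zero hd hD0), eq_div_iff (mul_ne_zero (mul_ne_zero hd hD1) (mul_ne_zero hd hD0))]
  apply mul_left_cancel₀ hkN
  linear_combination ((-1 : ℚ) ^ k * ((((n + 4).choose k : ℕ)) : ℚ) * dnv n) * tw
    + (((k : ℚ) + 1) * (-1 : ℚ) ^ k * ((evalList (P 0) (n : ℤ) : ℤ) : ℚ) * (Lsum n (k : ℚ) * Rsum n (k : ℚ)) * dnv n * dnv n * Dc n (k : ℚ) * Dc n ((k : ℚ) + 1)) * hB0 + (((k : ℚ) + 1) * (-1 : ℚ) ^ k * ((evalList (P 1) (n : ℤ) : ℤ) : ℚ) * (Lsum (n + 1) (k : ℚ) * Rsum (n + 1) (k : ℚ)) * dnv n * dnv n * Dc n (k : ℚ) * Dc n ((k : ℚ) + 1)) * hB1 + (((k : ℚ) + 1) * (-1 : ℚ) ^ k * ((evalList (P 2) (n : ℤ) : ℤ) : ℚ) * (Lsum (n + 2) (k : ℚ) * Rsum (n + 2) (k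 : ℚ)) * dnv n * dnv n * Dc n (k : ℚ) * Dc n ((k : ℚ) + 1)) * hB2' + (((k : ℚ) + 1) * (-1 : ℚ) ^ k * ((evalList (P 3) (n : ℤ) : ℤ) : ℚ) * (Lsum (n + 3) (k : ℚ) * Rsum (n + 3) (k : ℚ)) * dnv n * dnv n * Dc n (k : ℚ) * Dc n ((k : ℚ) + 1)) * hB3 + (((k : ℚ) + 1) * (-1 : ℚ) ^ k * ((evalList (P 4) (n : ℤ) : ℤ) : ℚ) * (Lsum (n + 4) (k : ℚ) * Rsum (n + 4) (k : ℚ)) * dnv n * dnv n * Dc n (k : ℚ) * Dc n ((k : ℚ) + 1)) * hB4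
    + ((((n : ℚ) + 1) * ((n : ℚ) + 2) * ((n : ℚ) + 3) * ((n : ℚ) + 4)) * (-1 : ℚ) ^ k * (peval eM00 (V n ((k : ℚ) + 1)) * (Lsum n ((k : ℚ) + 1) * Rsum n ((k : ℚ) + 1)) + peval eM01 (V n ((k : ℚ) + 1)) * (Lsum n ((k : ℚ) + 1) * Rsum n ((k : ℚ) + 2)) + peval eM10 (V n ((k : ℚ) + 1)) * (Lsum n ((k : ℚ) + 2) * Rsum n ((k : ℚ) + 1)) + peval eM11 (V n ((k : ℚ) + 1)) * (Lsum n ((k : ℚ) + 2) * Rsum n ((k : ℚ) + 2)) + peval eM20 (V n ((k : ℚ) + 1)) * (Lsum n ((k : ℚ) + 3) * Rsum n ((k : ℚ) + 1)) + peval eM21 (V n ((k : ℚ) + 1)) * (Lsum n ((k : ℚ) + 3) * Rsum n ((k : ℚ) + 2))) * dnv n * Dc n (k : ℚ)) * hB2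

/-! ### Endpoints -/

/-- `G(n, n+5) = 0` (`C(n+4,n+5) = 0`). -/
theorem Gc_top (n : ℕ) : Gc n (n + 5) = 0 := by
  unfold Gc; rw [Nat.choose_eq_zero_of_lt (by omega)]; simp

/-- `κ₀(n,−1) = 0`: (R-K2) degenerates at `x = −1`. -/
theorem eta00_neg_one (w : ℚ) : eta00 w (-1) = 0 := by unfold eta00; ring

/-- `θ₀(n,−1) = 0`: (L-K3) degenerates at `x = −1`. -/
theorem thQ0_neg_one (w : ℚ) : thQ0 w (-1) = 0 := by unfold thQ0; ring

/-- The constant substitution `v₁ ↦ c`. -/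
def σx (c : ℤ) (k : ℕ) : Expr := if k = 1 then .num c else .var k

/-- `peval (substs (σx c) e) (V n x) = peval e (V n c)`. -/
theorem peval_σx (c : ℤ) (e : Expr) (he : varsLT 3 e = true) (n : ℕ) (x : ℚ) :
    peval (substs (σx c) e) (V n x) = peval e (V n c) := by
  refine peval_substs (σx c) 3 (V n x) (V n c) (fun k hk => ?_) e he
  interval_cases k
  · rfl
  · show (c : ℚ) = peval (.num c) (V n x); rw [peval_num]
  · rfl

/-- Endpoint identity 0 at `x = 0` (a polynomial identity in `n`; one Kronecker evaluation). -/
def eEND0 : Expr :=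
  Expr.sub (Expr.mul (substs (σx (-1)) eTh3) (Expr.sub (Expr.mul (substs (σx (-1)) eKap2) (substs (σx 0) eM00)) (Expr.mul (substs (σx (-1)) eKap1) (substs (σx 0) eM01)))) (Expr.mul (substs (σx (-1)) eTh1) (Expr.sub (Expr.mul (substs (σx (-1)) eKap2) (substs (σx 0) eM20)) (Expr.mul (substs (σx (-1)) eKap1) (substs (σx 0) eM21))))

/-- Endpoint identity 1 at `x = 0` (a polynomial identity in `n`; one Kronecker evaluation). -/
def eEND1 : Expr :=
  Expr.sub (Expr.mul (substs (σx (-1)) eTh3) (Expr.sub (Expr.mul (substs (σx (-1)) eKap2) (substs (σx 0) eM10)) (Expr.mul (substs (σx (-1)) eKap1) (substs (σx 0) eM11)))) (Expr.mul (substs (σx (-1)) eTh2) (Expr.sub (Expr.mul (substs (σx (-1)) eKap2) (substs (σx 0) eM20)) (Expr.mul (substs (σx (-1)) eKap1) (substs (σx 0) eM21))))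

set_option maxHeartbeats 1000000 in
/-- **`G(n,0) = 0`**: the numerator combination vanishes at `k₃ = 0`, by the degenerate `x = −1` instances of (R-K2), (L-K3). -/
theorem Msum_zero (n : ℕ) (hn : 3 ≤ n) (hK : ∀ m, n ≤ m → LK3At m) : Msum n 0 = 0 := by
  have hR := R_rel_K2_all n hn (-1)
  rw [eta00_neg_one, zero_mul, zero_add, show (-1 : ℚ) + 1 = 0 by norm_num, show (-1 : ℚ) + 2 = 1 by norm_num] at hR
  have hL := hK n le_rfl (-1)
  rw [thQ0_neg_one, zero_mul, zero_add, show (-1 : ℚ) + 1 = 0 by norm_num, show (-1 : ℚ) + 2 = 1 by norm_num,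
    show (-1 : ℚ) + 3 = 2 by norm_num] at hL
  have E0 : peval eEND0 (V n 0) = 0 := peval_eq_zero_of_kron eEND0 (by decide +kernel) (by decide +kernel) _ _ _
  have E1 : peval eEND1 (V n 0) = 0 := peval_eq_zero_of_kron eEND1 (by decide +kernel) (by decide +kernel) _ _ _
  simp only [eEND0, eEND1, peval_sub, peval_mul, peval_σx _ _ coeff_vars.2.1, peval_σx _ _ coeff_vars.2.2.1, peval_σx _ _ coeff_vars.2.2.2.2.2.2.2.1, peval_σx _ _ coeff_vars.2.2.2.2.2.2.2.2.1, peval_σx _ _ coeff_vars.2.2.2.2.2.2.2.2.2.1, peval_σx _ _ CertM00_vars, peval_σx _ _ CertM01_vars, peval_σx _ _ CertM10_vars, peval_σx _ _ CertM11_vars, peval_σx _ _ CertM20_vars, peval_σx _ _ CertM21_vars, Int.cast_zero, Int.cast_neg, Int.cast_one, eKap1_peval, eKap2_peval, eTh1_peval, eTh2_peval, eTh3_peval] at E0 E1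
  have hne : eta02 (n : ℚ) (-1) * thQ3 (n : ℚ) (-1) ≠ 0 := by
    rw [eta02_fac, thQ3_fac]
    have hn1 : (3 : ℚ) ≤ n := by exact_mod_cast hn
    have h1 : (2 : ℚ) * n - (-1) ≠ 0 := by intro h; linarith
    have h2 : (2 : ℚ) * n - (-1) - 1 ≠ 0 := by intro h; linarith
    have h3 : (2 : ℚ) * n - (-1) - 2 ≠ 0 := by intro h; linarith
    exact mul_ne_zero (mul_ne_zero h1 (pow_ne_zero _ h2)) (mul_ne_zero (mul_ne_zero (pow_ne_zero _ h1) (pow_ne_zero _ h2)) (pow_ne_zero _ h3))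
  apply mul_left_cancel₀ hne
  unfold Msum
  rw [zero_add, zero_add, mul_zero]
  linear_combination (thQ3 (n : ℚ) (-1) * (Lsum n 0 * peval eM01 (V n 0) + Lsum n 1 * peval eM11 (V n 0) + Lsum n 2 * peval eM21 (V n 0))) * hR
    + (Rsum n 0 * (eta02 (n : ℚ) (-1) * peval eM20 (V n 0) - eta01 (n : ℚ) (-1) * peval eM21 (V n 0))) * hL
    + (Rsum n 0 * Lsum n 0) * E0 + (Rsum n 0 * Lsum n 1) * E1

/-- `G(n,0) = 0`. -/
theorem Gc_zero (n : ℕ) (hn : 3 ≤ n) (hK : ∀ m, n ≤ m → LK3At m) : Gc n 0 = 0 := by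
  unfold Gc; rw [Nat.cast_zero, Msum_zero n hn hK]; simp

/-! ### Telescoping: the recurrence for `n ≥ 12` -/

/-- `A(n+i) = Σ_{k ≤ n+4} t_i(n,k)` for `i ≤ 4` (terms with `k > n+i` vanish). -/
theorem A_as_sum (n i : ℕ) (hi : i ≤ 4) : ((A (n + i) : ℤ) : ℚ) = ∑ k ∈ range (n + 5), tm n i k := by
  rw [A_cast]
  have h1 : ∑ k ∈ range (n + i + 1), (-1) ^ k * (((n + i).choose k : ℕ) : ℚ) * Lsum (n + i) (k : ℚ) * Rsum (n + i) (k : ℚ)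
      = ∑ k ∈ range (n + i + 1), tm n i k := sum_congr rfl (fun k _ => by unfold tm; ring)
  rw [h1]
  apply Finset.sum_subset (s₁ := range (n + i + 1)) (s₂ := range (n + 5))
  · intro k hk; rw [mem_range] at hk ⊢; omega
  · intro k hk hk'
    rw [mem_range] at hk hk'
    unfold tm
    rw [Nat.choose_eq_zero_of_lt (by omega)]
    simp

/-- **LEVEL 3 (modulo (L-K3)/(L-NK))**: for `n ≥ 12` the cell's order-4 operator annihilates `A` at `n`. -/
theorem recurrence_of_L (n : ℕ) (hn : 12 ≤ n) (hK : ∀ m, n ≤ m → LK3At m) (hN : ∀ m, n ≤ m → LNKAt m) :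
    opApply A n = 0 := by
  have h : ((opApply A n : ℤ) : ℚ) = 0 := by
    unfold opApply
    push_cast
    have h0 := A_as_sum n 0 (by omega)
    rw [Nat.add_zero] at h0
    rw [A_as_sum n 1 (by omega), A_as_sum n 2 (by omega), A_as_sum n 3 (by omega), A_as_sum n 4 (by omega), h0]
    rw [mul_sum, mul_sum, mul_sum, mul_sum, mul_sum, ← sum_add_distrib, ← sum_add_distrib, ← sum_add_distrib,
      ← sum_add_distrib]
    rw [Finset.sum_congr rfl fun k hk => termwise_nat n hn hK hN k (by have := mem_range.mp hk; omega)]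
    rw [Finset.sum_range_sub (Gc n), Gc_top, Gc_zero n (by omega) hK, sub_zero]
  exact_mod_cast h

end VIMInner.L3

end Summit.KontsevichZagierPeriods.Zeta5Search.Certificates
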